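import Summits.QuantumFields.YangMills.Theorems.AlphaInputsT3ACv3LinearLiftLocal
import Summits.QuantumFields.YangMills.Theorems.AlphaInputsT3ACv3LinearAvgSup
import Summits.QuantumFields.YangMills.Theorems.AlphaInputsT3ACv3AbelianLiftAvg
import HarnessLib

/-!
# `AlphaInputsT3ACv3LinearLiftSmooth` — (LL+) ★★★ THE SUP-SMALL EXACT LINEAR LIFT: the coarse one-form `A` on `T^{(k)}` is the EXACT `k`-fold (0.4)-linear average of a finest
# one-form `liftS k A` with `|curl| ≤ 18^d·sup|curl A|/L^{2k}` AND `sup|liftS k A| ≤ 18^d(2 + (d+1)18^d)·sup|A|/L^k` — cell `ym3-torus`, width seat `ym-ust-19936-w2` (g2)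

WHY (OWNER RULING g24-№4 2026-08-28: (FL) non-abelian := the `hLift` binder of `…v3InnerLiftFromRegionalThm1`, supplied by Newton on the (LL) engine; w1-19936 PROGRESS 6: update
`U ↦ exp(lift ξ)·U`).  Every NON-abelian use of the linear lift exponentiates it bond by bond, and the BCH commutator at a finest plaquette costs `sup²`; a `k`-UNIFORM fine-plaquette
budget `B·ε·L^{−2k}` therefore needs an exact lift that is `O(sup|A|/L^k)` in SUP, not only `O(sup|curl A|/L^{2k})` in curl.  The landed exact lift
`LinearLiftSpread.lift k A = S1 k A − dgrad(−Ψ_k(S1 k A) ∘ iterBlockOf k)` (p588015) absorbs the (0.4) coboundary by a BLOCK-CONSTANT gauge, so on every finest bond crossing a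
level-`k` block face `|lift k A| = |dgrad Ψ_k(S1 k A)| = |A − linAvgIter k (S1 k A)| = O(sup|A|)`: harmless for abelian data (the curl is blind to gradients), useless under `exp`.
WHAT.  The coboundary potential is interpolated SMOOTHLY instead: the coarse sites `toFine k y` are the CENTRES of the `k`-cells ([Balaban1987RG1] (0.1): `emb` = centre, `L` odd), and
the spread `S0` interpolates there EXACTLY (`σ(0) = 1`, `σ(±n) = 0`):
* §1 `sigma_zero`, `sigma_side`, `sigma_neg_side`; §2 `val_toFine` (`(toFine k y)_μ = y_μ·L^k + ⌊L^k/2⌋`), `qIdx_tOff_toFine`, `Psig_toFine`, ★ `S0_toFine : S0 k Φ (toFine k y) = Φ y`;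
* §3 the SMOOTH COBOUNDARY GAUGE `dgrad (S0 k Φ)`: ★ `linAvgIter_dgrad_S0 : linAvgIter k (dgrad (S0 k Φ)) = dgrad Φ` and ★ `abs_dgrad_S0_le : |dgrad (S0 k Φ) b| ≤ 18^d·sup|dgrad Φ|/L^k`
  (`dgrad ∘ S0 = S1 ∘ dgrad` + `abs_S1_le`); `S1_weight_eq_zero_of_not_near`, `abs_S1_le_local` (the `Near`-local sup bound of the spread);
* §4 ★★★ `liftS k A := S1 k A + dgrad (S0 k (Ψ_k(S1 k A)))`: `linAvgIter_liftS : linAvgIter k (liftS k A) = A` (EXACT on every coarse bond), `curlAt_liftS = S2 k (curlAt A)` (the SAME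
  curl as `lift`), `dgrad_psiIter_S1_eq : dgrad Ψ_k(S1 k A) = A − linAvgIter k (S1 k A)`, `abs_dgrad_psiIter_S1_le` (`≤ (1 + (d+1)18^d)·M`), ★★★ `abs_liftS_le`
  (`|liftS k A b| ≤ 18^d(2 + (d+1)18^d)·M/L^k`, `k`-UNIFORM), `abs_curlAt_liftS_le` (`≤ 18^d·ε/(L^k)²`), `abs_curlAt_liftS_le_local` (curl hypothesis on the `Near` cells only),
  ★★★ `exists_smoothLift_torus` (exactness ∧ curl ∧ sup at once); §5 `liftS_dgrad` (the lift of a pure gauge is the pure gauge of an interpolant: `liftS k (dλ) = d(S0 λ + S0 Ψ)`),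
  `liftS_dgrad_toFine` (that interpolant reads `λ + Ψ` at the centres).
HONEST FRAMING.  Finite-dimensional linear algebra on the lattice tori of [Balaban1987RG1] (0.1)–(0.4); count-neutral helper toward the (FL) row of 2′∕2′χ (`--supports
stmt-QuantumFields-19936`); (FL)∕`hLift` is NOT proved here; nothing of [Balaban1985UV3]∕[Balaban1985Variational] is asserted; registry untouched.  YM₃ on the three-torus is RUNG R3 of
the programme, not the Clay problem; no claim about d = 4, infinite volume or a mass gap.

References: T. Bałaban, Commun. Math. Phys. 109 (1987) 249–301 [Balaban1987RG1] ((0.1) p.251, (0.4)+(0.11) p.253); Commun. Math. Phys. 98 (1985) 17–51 [Balaban1985Averaging]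
((125) p.36, bookkeeping of sup norms).
-/

set_option autoImplicit false

noncomputable section

namespace Summit.QuantumFields.YangMills.Theorems.LinearLiftSpread

open Finset
open Literature.MathematicalPhysics.QuantumFieldTheory.Balaban1983to89
open Literature.MathematicalPhysics.QuantumFieldTheory.Balaban1983to89.B10Eq38TorusDomains (toFine toFine_zero toFine_succ)
open Summit.QuantumFields.YangMills.Theorems.AbelianEML (linAvgIter curlAt linAvgIter_add curlAt_add)
open Summit.QuantumFields.YangMills.Theorems.LinearLiftGauge (dgrad dgrad_add segIter psiIter linAvgIter_eq_segIter_sub linAvgIter_dgrad)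
open Summit.QuantumFields.YangMills.Theorems.LinearLiftProfile
open Summit.QuantumFields.YangMills.Theorems.LinearAvgSup (abs_S1_le abs_linAvgIter_le)

variable {P : Params}

/-! ## §1 The 0-form profile at the centre and at the neighbouring centres -/

/-- **`σ(0) = 1`**: at the centre of its cell the 0-form profile is `n⁻¹ Σ_u ρ(u) = 1` (every `u` in the support has `|u| ≤ 2p ≤ h`). [cite: Balaban1987RG1, (0.1) p.251] -/
theorem sigma_zero (h : ℕ) : sigma h 0 = 1 := by
  unfold sigma
  have h2 := two_prad_le h
  have hbox : ∀ u ∈ rsupp h, rho h u * box h (0 - u) = rho h u := by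
    intro u hu
    rw [mem_rsupp] at hu
    have hb : LinearLiftProfile.box h (0 - u) = 1 := by
      unfold LinearLiftProfile.box
      rw [if_pos]
      constructor <;> omega
    rw [hb, mul_one]
  rw [sum_congr rfl hbox, sum_rho, inv_mul_cancel₀ (side_real_pos h).ne']

/-- **`σ(n) = 0`**: the profile vanishes at the centre of the next cell (`n = 2h + 1 > h + 2p`). [cite: Balaban1987RG1, (0.1) p.251] -/
theorem sigma_side (h : ℕ) : sigma h (side h) = 0 := by
  have h2 := two_prad_le h
  refine sigma_eq_zero h (Or.inr ?_)
  rw [side_int]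
  omega

/-- **`σ(−n) = 0`**: the profile vanishes at the centre of the previous cell. [cite: Balaban1987RG1, (0.1) p.251] -/
theorem sigma_neg_side (h : ℕ) : sigma h (-(side h : ℤ)) = 0 := by
  have h2 := two_prad_le h
  refine sigma_eq_zero h (Or.inl ?_)
  rw [side_int]
  omega

/-! ## §2 The coarse sites sit at the centres of their cells; `S0` interpolates there exactly -/

/-- **THE LABEL OF A COARSE SITE IN THE FINEST TORUS**: `(toFine k y)_μ = y_μ·L^k + ⌊L^k/2⌋` — the CENTRE of the `k`-cell of `y` (`emb` is the centred inclusion, `L` odd; standing range,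
no reduction modulo the site count). [cite: Balaban1987RG1, (0.1) p.251] -/
theorem val_toFine : ∀ (k : ℕ), k ≤ P.m + P.K → ∀ (y : Site P k) (μ : Fin P.d),
    ((toFine k y) μ).val = (y μ).val * P.L ^ k + P.L ^ k / 2
  | 0, _, y, μ => by simp
  | k + 1, hk, y, μ => by
    rw [toFine_succ, val_toFine k (by omega) (emb y) μ, Site.val_emb (by omega) y μ]
    obtain ⟨s, hs⟩ := P.hL.1
    obtain ⟨r, hr⟩ := (P.hL.1.pow : Odd (P.L ^ k))
    obtain ⟨t, ht⟩ : ∃ t : ℕ, t = r * s := ⟨_, rfl⟩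
    have h3 : P.L ^ (k + 1) = 2 * (2 * t + r + s) + 1 := by rw [pow_succ, hr, hs, ht]; ring
    have h1 : (P.L - 1) / 2 = s := by omega
    have h2 : P.L ^ k / 2 = r := by omega
    have h4 : P.L ^ (k + 1) / 2 = 2 * t + r + s := by omega
    rw [h1, h2, h4, h3, hr, hs, ht]
    ring

/-- **CELL INDEX AND OFFSET OF A COARSE SITE**: `q((toFine k y)_μ) = y_μ` and `t((toFine k y)_μ) = 0` (the centre). [cite: Balaban1987RG1, (0.1) p.251] -/
theorem qIdx_tOff_toFine (k : ℕ) (hk : k ≤ P.m + P.K) (y : Site P k) (μ : Fin P.d) :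
    qIdx (hh P k) ((toFine k y) μ) = (y μ).val ∧ tOff (hh P k) ((toFine k y) μ) = 0 := by
  refine qIdx_tOff_of_val (hh P k) ?_ (by omega) (by positivity)
  have e : ((hh P k : ℕ) : ℤ) = ((P.L ^ k / 2 : ℕ) : ℤ) := rfl
  rw [val_toFine k hk y μ, hside, e]
  generalize P.L ^ k / 2 = c
  push_cast
  ring

/-- **THE 0-FORM PROFILE OF THE CELL `c` READ AT A COARSE SITE** is the indicator of that site's cell: `Pσ((toFine k y)_μ, c) = [c = y_μ]` (`σ(0) = 1`, `σ(±n) = 0`).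
[cite: Balaban1987RG1, (0.1) p.251] -/
theorem Psig_toFine (k : ℕ) (hk : k ≤ P.m + P.K) (y : Site P k) (μ : Fin P.d) (c : ZMod (P.sitesPerDir k)) :
    Psig (hh P k) ((toFine k y) μ) c = if c = y μ then 1 else 0 := by
  obtain ⟨hq, ht⟩ := qIdx_tOff_toFine k hk y μ
  unfold Psig PS
  rw [hq, ht, sum_trip]
  have e0 : (((((y μ).val : ℕ) : ℤ) - 0 : ℤ) : ZMod (P.sitesPerDir k)) = y μ := by simp
  rw [show (0 : ℤ) + (-1) * (side (hh P k) : ℤ) = -(side (hh P k) : ℤ) by ring, show (0 : ℤ) + 0 * (side (hh P k) : ℤ) = 0 by ring,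
    show (0 : ℤ) + 1 * (side (hh P k) : ℤ) = side (hh P k) by ring, sigma_neg_side, sigma_side, sigma_zero, e0, ite_self, ite_self,
    zero_add, add_zero]

/-- **★ THE SPREAD OF A COARSE 0-FORM INTERPOLATES IT EXACTLY AT THE COARSE SITES**: `S0 k Φ (toFine k y) = Φ y`. [cite: Balaban1987RG1, (0.1) p.251] -/
theorem S0_toFine (k : ℕ) (hk : k ≤ P.m + P.K) (Φ : Site P k → ℝ) (y : Site P k) : S0 k Φ (toFine k y) = Φ y := by
  unfold S0
  have hw : ∀ y' : Site P k, (∏ i, Psig (hh P k) ((toFine k y) i) (y' i)) = if y = y' then 1 else 0 := by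
    intro y'
    simp_rw [Psig_toFine k hk y]
    rw [Fintype.prod_boole]
    by_cases hy : y = y'
    · subst hy; simp
    · rw [if_neg hy, if_neg]
      intro hall
      exact hy (funext fun i => (hall i).symm)
  simp_rw [hw, mul_ite, mul_one, mul_zero]
  rw [Finset.sum_ite_eq]
  simp

/-- `S0 k Φ ∘ toFine k = Φ`. [cite: Balaban1987RG1, (0.1) p.251] -/
theorem S0_comp_toFine (k : ℕ) (hk : k ≤ P.m + P.K) (Φ : Site P k → ℝ) : (S0 k Φ) ∘ toFine k = Φ :=
  funext fun y => S0_toFine k hk Φ y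

/-! ## §3 The smooth coboundary gauge `dgrad (S0 k Φ)` -/

section Smooth

variable (k : ℕ) (hk : k ≤ P.m + P.K)
include hk

/-- **★ THE `k`-FOLD (0.4)-LINEAR AVERAGE OF THE SMOOTH COBOUNDARY GAUGE IS THE COARSE COBOUNDARY**: `linAvgIter k (d(S0 Φ)) = dΦ` (the average of a pure gauge reads it at the centres,
where `S0` interpolates exactly). [cite: Balaban1987RG1, (0.4)+(0.11) p.253] -/
theorem linAvgIter_dgrad_S0 (Φ : Site P k → ℝ) : linAvgIter k (dgrad (S0 k Φ)) = dgrad Φ := by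
  rw [linAvgIter_dgrad, S0_comp_toFine k hk Φ]

/-- **★ THE SMOOTH COBOUNDARY GAUGE IS `L^{−k}`-SMALL BOND BY BOND**: `|d(S0 Φ)(b)| ≤ 18^d·M/L^k` when `|dΦ| ≤ M` on the coarse bonds (`d ∘ S0 = S1 ∘ d` and the sup bound of the spread of
a one-form). [cite: Balaban1985Averaging, (125) p.36 (bookkeeping)] -/
theorem abs_dgrad_S0_le (Φ : Site P k → ℝ) {M : ℝ} (hM : ∀ c : PBond P k, |dgrad Φ c| ≤ M) (b : PBond P 0) :
    |dgrad (S0 k Φ) b| ≤ (18 : ℝ) ^ P.d * M / (P.L : ℝ) ^ k := by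
  rw [dgrad_S0 k hk Φ]
  exact abs_S1_le k (dgrad Φ) hM b

omit hk in
/-- Off the `3^d`-cell neighbourhood the `S¹`-weight vanishes (one coordinate profile is `0` by `PS_eq_zero_of_far`). [folklore] -/
theorem S1_weight_eq_zero_of_not_near (b : PBond P 0) (y : Site P k) (hy : ¬ Near k b.src y) :
    Ptau (hh P k) (b.src b.dir) (y b.dir) * ∏ i ∈ univ.erase b.dir, Psig (hh P k) (b.src i) (y i) = 0 := by
  unfold Near at hy
  push Not at hy
  obtain ⟨i, hi⟩ := hy
  have hfar : ∀ r ∈ trip, y i ≠ (((qIdx (hh P k) (b.src i) : ℤ) - r : ℤ) : ZMod (P.sitesPerDir k)) := fun r hr h => hi r hr h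
  by_cases hμ : i = b.dir
  · subst hμ
    have : Ptau (hh P k) (b.src b.dir) (y b.dir) = 0 := PS_eq_zero_of_far (hh P k) (tau (hh P k)) _ _ (y b.dir) hfar
    rw [this]; ring
  · have hmem : i ∈ univ.erase b.dir := mem_erase.mpr ⟨hμ, mem_univ i⟩
    have : Psig (hh P k) (b.src i) (y i) = 0 := PS_eq_zero_of_far (hh P k) (sigma (hh P k)) _ _ (y i) hfar
    rw [prod_eq_zero hmem this]; ring

/-- **THE LOCAL SUP BOUND OF THE SPREAD OF A ONE-FORM**: `|S1 k A (b)| ≤ 18^d·M/L^k` as soon as `|A(y, μ_b)| ≤ M` for the coarse sites `y` NEAR `b₋` only.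
[cite: Balaban1985Averaging, (125) p.36 (bookkeeping)] -/
theorem abs_S1_le_local (A : PBond P k → ℝ) (b : PBond P 0) {M : ℝ} (hA : ∀ y : Site P k, Near k b.src y → |A ⟨y, b.dir⟩| ≤ M) :
    |S1 k A b| ≤ (18 : ℝ) ^ P.d * M / (P.L : ℝ) ^ k := by
  classical
  let A' : PBond P k → ℝ := fun c => if Near k b.src c.src then A ⟨c.src, b.dir⟩ else 0
  have hS : S1 k A b = S1 k A' b := by
    unfold S1
    refine sum_congr rfl fun y _ => ?_
    by_cases hy : Near k b.src y
    · simp only [A', if_pos hy]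
    · simp only [A', if_neg hy]
      rw [S1_weight_eq_zero_of_not_near k b y hy]; ring
  rw [hS]
  have hM : 0 ≤ M := (abs_nonneg _).trans (hA _ (near_self k hk b.src))
  refine abs_S1_le k A' (fun c => ?_) b
  by_cases hy : Near k b.src c.src
  · simp only [A', if_pos hy]; exact hA c.src hy
  · simp only [A', if_neg hy, abs_zero]; exact hM

end Smooth

/-! ## §4 The sup-small exact lift -/

/-- **★★★ THE SUP-SMALL EXACT LINEAR LIFT** of a coarse one-form `A` on `T^{(k)}` to the finest torus: the spread `S1 k A` corrected by the SMOOTH pure gauge `d(S0(Ψ_k(S1 k A)))` that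
absorbs the (0.4) coboundary (the potential interpolated by `S0`, exact at the centres — not the block-constant extension of `lift`). [cite: Balaban1987RG1, (0.4)+(0.11) p.253] -/
def liftS (k : ℕ) (A : PBond P k → ℝ) : PBond P 0 → ℝ :=
  S1 k A + dgrad (S0 k (psiIter k (S1 k A)))

section Lift

variable (k : ℕ) (hk : k ≤ P.m + P.K)
include hk

/-- **★★ EXACTNESS**: `linAvgIter k (liftS k A) = A` — the `k`-fold (0.4)-linear average of the smooth lift IS the coarse one-form (`linAvgIter k (S1 A) = A − dΨ` by biorthogonality and
the coboundary identity; `linAvgIter k (d(S0 Ψ)) = dΨ`). [cite: Balaban1987RG1, (0.4)+(0.11) p.253] -/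
theorem linAvgIter_liftS (A : PBond P k → ℝ) : linAvgIter k (liftS k A) = A := by
  unfold liftS
  rw [linAvgIter_add, linAvgIter_dgrad_S0 k hk, linAvgIter_eq_segIter_sub, segIter_S1 k hk]
  funext b
  simp only [Pi.add_apply, Pi.sub_apply]
  ring

/-- **★★ THE CURL OF THE SMOOTH LIFT IS THE SPREAD OF THE COARSE CURL** (the same as for `lift`: the two lifts differ by a gradient): `curlAt (liftS k A) x μ ν = S2 k (curlAt A) x μ ν`
(`μ ≠ ν`). [cite: Balaban1987RG1, (0.4) p.253] -/
theorem curlAt_liftS (A : PBond P k → ℝ) (x : Site P 0) {μ ν : Fin P.d} (hμν : μ ≠ ν) :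
    curlAt (liftS k A) x μ ν = S2 k (fun y μ' ν' => curlAt A y μ' ν') x μ ν := by
  unfold liftS
  rw [curlAt_add, curlAt_dgrad, add_zero, curlAt_S1 k hk A x hμν]

/-- **THE COBOUNDARY DEFECT OF THE SPREAD**: `dΨ_k(S1 k A) = A − linAvgIter k (S1 k A)` (`linAvgIter k = M^k − dΨ_k` and `M^k (S1 A) = A`). [cite: Balaban1987RG1, (0.4)+(0.11) p.253] -/
theorem dgrad_psiIter_S1_eq (A : PBond P k → ℝ) : dgrad (psiIter k (S1 k A)) = A - linAvgIter k (S1 k A) := by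
  have h := linAvgIter_eq_segIter_sub (S1 k A) k
  rw [segIter_S1 k hk] at h
  rw [h]
  funext c
  simp only [Pi.sub_apply]
  ring

/-- **THE COBOUNDARY DEFECT IS `O(sup|A|)` WITH A `k`-UNIFORM CONSTANT**: `|dΨ_k(S1 k A)(c)| ≤ (1 + (d+1)·18^d)·M` when `|A| ≤ M` (`|linAvgIter k a| ≤ (d+1)L^k·sup|a|` of
`…LinearAvgSup` against `|S1 A| ≤ 18^d·M/L^k`). [cite: Balaban1985Averaging, (125) p.36 (bookkeeping)] -/
theorem abs_dgrad_psiIter_S1_le (A : PBond P k → ℝ) {M : ℝ} (hM : ∀ c, |A c| ≤ M) (c : PBond P k) :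
    |dgrad (psiIter k (S1 k A)) c| ≤ (1 + ((P.d : ℝ) + 1) * (18 : ℝ) ^ P.d) * M := by
  rw [dgrad_psiIter_S1_eq k hk A, Pi.sub_apply]
  have hL : (0 : ℝ) < (P.L : ℝ) ^ k := pow_pos (by exact_mod_cast P.L_pos) k
  have h1 := hM c
  have h2 : |linAvgIter k (S1 k A) c| ≤ ((P.d : ℝ) + 1) * (P.L : ℝ) ^ k * ((18 : ℝ) ^ P.d * M / (P.L : ℝ) ^ k) :=
    abs_linAvgIter_le (S1 k A) (fun b => abs_S1_le k A hM b) k c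
  calc |A c - linAvgIter k (S1 k A) c| ≤ |A c| + |linAvgIter k (S1 k A) c| := abs_sub _ _
    _ ≤ M + ((P.d : ℝ) + 1) * (P.L : ℝ) ^ k * ((18 : ℝ) ^ P.d * M / (P.L : ℝ) ^ k) := add_le_add h1 h2
    _ = (1 + ((P.d : ℝ) + 1) * (18 : ℝ) ^ P.d) * M := by
        field_simp

/-- **★★★ THE SMOOTH LIFT IS `L^{−k}`-SMALL IN SUP, UNIFORMLY IN `k`**: `|liftS k A (b)| ≤ 18^d·(2 + (d+1)·18^d)·M/L^k` when `|A| ≤ M` — the spread is `18^d·M/L^k` and the smooth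
coboundary gauge `18^d·(1 + (d+1)18^d)·M/L^k`.  (The block-constant gauge of `lift` is `O(M)` on the block faces.) [cite: Balaban1985Averaging, (125) p.36 (bookkeeping)] -/
theorem abs_liftS_le (A : PBond P k → ℝ) {M : ℝ} (hM : ∀ c, |A c| ≤ M) (b : PBond P 0) :
    |liftS k A b| ≤ (18 : ℝ) ^ P.d * (2 + ((P.d : ℝ) + 1) * (18 : ℝ) ^ P.d) * M / (P.L : ℝ) ^ k := by
  unfold liftS
  rw [Pi.add_apply]
  have h1 := abs_S1_le k A hM b
  have h2 := abs_dgrad_S0_le k hk (psiIter k (S1 k A)) (abs_dgrad_psiIter_S1_le k hk A hM) b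
  calc |S1 k A b + dgrad (S0 k (psiIter k (S1 k A))) b| ≤ |S1 k A b| + |dgrad (S0 k (psiIter k (S1 k A))) b| := abs_add_le _ _
    _ ≤ (18 : ℝ) ^ P.d * M / (P.L : ℝ) ^ k + (18 : ℝ) ^ P.d * ((1 + ((P.d : ℝ) + 1) * (18 : ℝ) ^ P.d) * M) / (P.L : ℝ) ^ k := add_le_add h1 h2
    _ = (18 : ℝ) ^ P.d * (2 + ((P.d : ℝ) + 1) * (18 : ℝ) ^ P.d) * M / (P.L : ℝ) ^ k := by ring

/-- **THE CURL BOUND OF THE SMOOTH LIFT ON THE WHOLE TORUS**: `|curlAt (liftS k A) x μ ν| ≤ 18^d·ε/(L^k)²` when `|curlAt A y μ ν| ≤ ε` everywhere. [cite: Balaban1987RG1, (0.4) p.253] -/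
theorem abs_curlAt_liftS_le (A : PBond P k → ℝ) (x : Site P 0) {μ ν : Fin P.d} (hμν : μ ≠ ν) {ε : ℝ} (hA : ∀ y : Site P k, |curlAt A y μ ν| ≤ ε) :
    |curlAt (liftS k A) x μ ν| ≤ (18 : ℝ) ^ P.d * ε / ((P.L : ℝ) ^ k) ^ 2 := by
  rw [curlAt_liftS k hk A x hμν]
  exact abs_S2_le k (fun y μ' ν' => curlAt A y μ' ν') x hμν fun y => hA y

/-- **THE LOCAL CURL BOUND OF THE SMOOTH LIFT**: `|curlAt (liftS k A) x μ ν| ≤ 18^d·ε/(L^k)²` as soon as `|curlAt A y μ ν| ≤ ε` for the coarse sites `y` NEAR `x` (interior cells of any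
union of level-`k` cells inherit the bound from a hypothesis on the 1-cell thickening only). [cite: Balaban1987RG1, (0.4) p.253] -/
theorem abs_curlAt_liftS_le_local (A : PBond P k → ℝ) (x : Site P 0) {μ ν : Fin P.d} (hμν : μ ≠ ν) {ε : ℝ}
    (hA : ∀ y : Site P k, Near k x y → |curlAt A y μ ν| ≤ ε) :
    |curlAt (liftS k A) x μ ν| ≤ (18 : ℝ) ^ P.d * ε / ((P.L : ℝ) ^ k) ^ 2 := by
  rw [curlAt_liftS k hk A x hμν]
  exact abs_S2_le_local k hk (fun y μ' ν' => curlAt A y μ' ν') x hμν hA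

/-- **★★★ (LL+) ON THE FULL TORUS — EXACT, CURL-SMALL AND SUP-SMALL AT ONCE**: every coarse one-form `A` on `T^{(k)}` with `|curl A| ≤ ε` and `|A| ≤ M` is the EXACT `k`-fold (0.4)-linear
average of a finest one-form with `|curl| ≤ 18^d·ε/(L^k)²` and `|·| ≤ 18^d(2 + (d+1)18^d)·M/L^k` (both constants ABSOLUTE: no `L`, `k`, volume). [cite: Balaban1987RG1, (0.4)+(0.11) p.253] -/
theorem exists_smoothLift_torus (A : PBond P k → ℝ) {ε M : ℝ} (hA : ∀ (y : Site P k) (μ ν : Fin P.d), μ ≠ ν → |curlAt A y μ ν| ≤ ε) (hM : ∀ c, |A c| ≤ M) :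
    ∃ a : PBond P 0 → ℝ, linAvgIter k a = A ∧
      (∀ (x : Site P 0) (μ ν : Fin P.d), μ ≠ ν → |curlAt a x μ ν| ≤ (18 : ℝ) ^ P.d * ε / ((P.L : ℝ) ^ k) ^ 2) ∧
      ∀ b : PBond P 0, |a b| ≤ (18 : ℝ) ^ P.d * (2 + ((P.d : ℝ) + 1) * (18 : ℝ) ^ P.d) * M / (P.L : ℝ) ^ k :=
  ⟨liftS k A, linAvgIter_liftS k hk A, fun x μ ν hμν => abs_curlAt_liftS_le k hk A x hμν fun y => hA y μ ν hμν, abs_liftS_le k hk A hM⟩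

/-! ## §5 The lift of a pure gauge is a pure gauge -/

/-- **THE SMOOTH LIFT OF A COARSE PURE GAUGE IS A FINEST PURE GAUGE**: `liftS k (dλ) = d(S0 λ + S0 (Ψ_k(S1 (dλ))))` (`S1 ∘ d = d ∘ S0`) — the letter behind the frame-change bookkeeping
of any blockwise-gauge use of the lift. [cite: Balaban1987RG1, (0.4)+(0.11) p.253] -/
theorem liftS_dgrad (lam : Site P k → ℝ) : liftS k (dgrad lam) = dgrad (S0 k lam + S0 k (psiIter k (S1 k (dgrad lam)))) := by
  unfold liftS
  rw [← dgrad_S0 k hk lam, dgrad_add]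

/-- … and that finest potential READS `λ + Ψ_k(S1(dλ))` at the coarse sites (so its centre values differ from `λ` by a 0-form whose coarse gradient is `dλ − linAvgIter k (S1 (dλ))`).
[cite: Balaban1987RG1, (0.4)+(0.11) p.253] -/
theorem liftS_dgrad_toFine (lam : Site P k → ℝ) (y : Site P k) :
    (S0 k lam + S0 k (psiIter k (S1 k (dgrad lam)))) (toFine k y) = lam y + psiIter k (S1 k (dgrad lam)) y := by
  rw [Pi.add_apply, S0_toFine k hk, S0_toFine k hk]

end Lift

end Summit.QuantumFields.YangMills.Theorems.LinearLiftSpread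

end
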